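import Summits.HodgeConjecture.HodgeConjecture.Theorems.Ring2AbelianAllFrameRankFour
import Summits.HodgeConjecture.HodgeConjecture.Theorems.Ring2AbelianAllSpreadExistential
import Summits.HodgeConjecture.HodgeConjecture.Theorems.Ring2AbelianAllAndreWeilPencils
import Summits.HodgeConjecture.HodgeConjecture.Theorems.Ring2AbelianAllAndreFibreClassRange
import Summits.HodgeConjecture.HodgeConjecture.Theorems.Ring2AbelianAllAndreWeilPencilsCMPower
import Summits.HodgeConjecture.HodgeConjecture.Theorems.Ring2WeilTypeHodgeRing
import HarnessLib

/-!
# Ring 2 around `HC_CM` — `HC(all abelian varieties) ⟸ HC_CM + B`, FRAME V: the four fact-free bottoms in the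
`E`-rank-4 column, and the junction of the pencil axis with the cell's Weil-type target (typer 1, cell LEAD)

HONEST FRAMING (page 1, verbatim in every file of this cell): research route conditional on HC_CM; not a
corollary; Q11.4-sentence-2 already refuted in dim ≥ 3. AbelianAll sub-cell line (verbatim): research route, not a corollary; conditional on HC_CM plus one named minimal statement.

`HC_CM` := `Theses.RankFourFaces.CMAbelianHodge` (item stmt-HodgeConjecture-3052) and `HC_AV` :=
`Theses.PadicSemiregularLift.HodgeAbelianVarieties` are OPEN; below they occur only as HYPOTHESES by name, inside the
grammar words of Frame I (`ClosesWithCM B := HC_CM → B → HC_AV`, `ExactWithCM`, `CMIdle`), or as the CONCLUSION of an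
implication all of whose open inputs are explicit binders. Printed theorems enter as the tree's NAMED FACTS taken as
hypotheses, never asserted: `h₂₁ : andre1996_cmAnchoredPencil` (André 1996 Lemme 6.3.1, REFEREED),
`hF : deligne1982_cmDenseMumfordTateFamilies` (Deligne 1982 Prop. 6.1 via Charles–Schnell 11.5.11, REFEREED),
`h𝔄 : Andre1992_hodgeClasses_cmAbelianVariety_mem_span_pullback_weilClasses` (REFEREED),
`h83 : Hazama2003_generalHodge_cmType_of_hodge_codimTwo` (REFEREED), and the CLAIM-tagged floor
`hF1 : Markman2025_weilClasses_algebraic_abelianFourfold` (F1; arXiv:2502.03415 Cor. 1.6.1, UNREFEREED in general).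
No `sorry`, no new definition, no new named fact; nothing of the files composed here is re-derived (BY NAME only).

THE SOURCES (first-hand quotations sit in the records composed here): André 1996 §6.3 pp. 31–33, Lemme 6.3.1, Remarque 2
[Andre1996Motifs]; Abdulali 1994 Thm. 5.5 p. 1130 [Abdulali1994FamiliesAV]; Deligne 1982 Prop. 6.1 [Deligne1982HodgeCycles] with
Charles–Schnell Cor. 11.3.6, Thm. 11.5.11/21 [CharlesSchnell2014Notes]; van Geemen LNM 1594 Thm. 4.11, 6.12 (PDF pp. 218–220, 232: the
Hodge ring of the GENERAL member of each `n²`-dimensional Weil-type family is generated by divisors and the Weil plane), 5.3–5.8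
[vanGeemen1994HodgeAV]; Weil 1977 [Weil1977HodgeRing]; Hazama 2003 Thm. 8.3 p. 655 [Hazama2003GHCCM], André 1992 [Andre1992HodgeCM].

WHAT THIS FILE ADDS (Frame IV, spread IV, ab V / VII / VIII / IX and typer 1's `Ring2WeilTypeHodgeRing` are used BY NAME; nothing re-proved).
§B THE FOUR FACT-FREE BOTTOMS, one census line. As of rev. 1 the cell had exactly four typed complements `B` of `HC_CM` with
  `ClosesWithCM B` and NO named fact: (T∃) `CMAnchoredPencilTransport` (ab II), CPS_∃ `Deform.CMAnchoredPencilCMSpreading` (deform IX),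
  U_∃ `CMDenseFamilyCMSpreading` (spread IV), (β∃) `CMAnchoredPencilFibreClassLefschetz` (ab V). `closesWithCM_bottoms` records the
  conjunction, `closesWithCM_bottoms_or` the disjunction as ONE closing candidate, `bottoms_edges` the unconditional arrows among them
  ((β∃) → (T∃) → CPS_∃ → CMToAbelian ← U_∃). Each still implies `CMToAbelian` (item 16267, OPEN) — none is claimed.
§E THE BOTTOMS IN THE `E`-RANK-4 COLUMN (Frame IV rows instantiated): `F1 → item 16268 → (any bottom) → HC_AV` and
  `CMIdle (F1 ∧ item 16268 ∧ (T∃ ∨ CPS_∃ ∨ U_∃ ∨ β∃))` mod André 1992 + Hazama 2003 (NO `HC_CM` binder); the exact rows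
  `HC_AV ↔ F1 ∧ item 16268 ∧ U_∃` (mod + Deligne's family fact), `… ∧ CPS_∃`, `… ∧ (T∃)` (mod + Lemme 6.3.1) — the KIND-2
  row asked for by ab-spread-1 (`exactWithCM_cmDenseFamilyCMSpreading`), now with `F1 ∧ item 16268` in place of `HC_CM`.
§W THE WEIL-TYPE JUNCTION (pencil axis ⟶ the cell's first kernel target). ab VII reaches the ladder rung R∞ (`WeilClassesImaginaryQuadratic`)
  from `HC_CM`, compact Weil pencils through CM points `(W)ₙ` and transport (or the fibre-class Lefschetz input) at relative dimension
  `2n` only; typer 1's `Ring2WeilTypeHodgeRing` turns R∞ into `HC_WeilTypeDW[]` := HC for every Weil-type `(A, φ, n, d)` whose Hodge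
  ring is divisor–Weil generated (van Geemen 6.12: the general member). Composed: `HC_CM ∧ (∀ n ≥ 2, (W)ₙ) ∧ (∀ n ≥ 2, T@2n  or  β@2n) ⟹ HC_WeilTypeDW[]`, its per-level
  slice (one `n`: inputs `(W)ₙ`, `T@2n`), its smallest rung `HC_CM ∧ (W)₂ ∧ T@4 ⟹ F1`, and the `E`-rank-4 reading
  `F1 ∧ item 16268 ∧ (W) ∧ β ⟹ R∞ ⟹ HC_WeilTypeDW[]` mod André + Hazama — rank FOUR Weil classes for CM fields plus the
  pencil inputs give the Weil classes of EVERY imaginary quadratic field. CONDITIONAL on open inputs; nothing is closed.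
§W″ (rev. 3, ab IX `Ring2AbelianAllAndreWeilPencilsCMPower` ∘ WΔ): with the Weil pencils anchored at `E`-POWER fibres, `(W_E)ₙ`,
  Tate's theorem on `Eᴺ` (tree theorem) replaces `HC_CM`: `(∀ n ≥ 2, (W_E)ₙ) ∧ (∀ n ≥ 2, T@2n or β′@2n) ⟹ HC_WeilTypeDW[]` with NO
  `HC_CM`, NO named fact, NO `E`-rank-4 input — `HC_CM` is IDLE on the whole Weil-type junction (it stays load-bearing for `HC_AV`).
§A AUDIT: every HC-shaped conclusion here follows from `HodgeConjecture` (on path); the transport input at every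
  relative dimension is itself a consequence of HC (ab VII), so no TRANSPORT row is vacuous (the unprimed β-rows ARE — see the
  ERRATUM below; `(W)ₙ` and the repaired β′-inputs are not known to follow from HC); no minimality claim is moved.

ERRATUM FOLDED (rev. 2, after ab VIII `Ring2AbelianAllAndreFibreClassRange`, p198640). ab-andre-2's self-audit REFUTED (misstated)
  the unbounded fibre-class nodes of parts V / VII (`FibreClassLefschetzFor hf` asks for a correspondence in EVERY degree `p`, impossible
  for `p ≥ d + 2`: `not_fibreClassLefschetzFor`); so (β∃) `CMAnchoredPencilFibreClassLefschetz`, (β) `FibreClassLefschetzCMPointedPencils`,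
  (β)_d `FibreClassLefschetzAtRelDim d` are NEVER INSTANTIABLE: in §B the (β∃) conjunct / disjunct is EMPTY (instantiable fact-free
  bottoms: (T∃), CPS_∃, U_∃, (β∃′) — with ab-spread-1 VI's common floor FS_∃ below CPS_∃ and U_∃); in §E / §W every row with `hβ` over
  an unprimed node is TRUE BUT VACUOUS and superseded by its primed version (§B′ / §W′) on ab VIII's repaired nodes (β∃′)
  `CMAnchoredPencilFibreClassLefschetzOn`, (β′) `FibreClassLefschetzOnCMPointedPencils`, (β′)_d `FibreClassLefschetzOnAtRelDim d` (degrees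
  `p ≤ d`). Transport, CPS_∃ / U_∃ rows and the audit are UNAFFECTED; whether the (β′)-nodes follow from HC is not decided in the tree.

References (bib keys): those of THE SOURCES above, and MoonenZarhin1998WeilClasses (§1), Markman2025SecantWeil (Cor. 1.6.1,
UNREFEREED), Markman2025SurveySecant (Thm. 1.2), Deligne2000 (§1).
-/

set_option linter.dupNamespace false
noncomputable section
namespace Summit.HodgeConjecture.HodgeConjecture.Ring2.AbelianAll

open CategoryTheory Literature.AlgebraicGeometry Literature.AlgebraicGeometry.Motives Literature.AlgebraicGeometry.HodgeTheory
open Literature.AlgebraicGeometry.Andre1996 (andre1996_cmAnchoredPencil)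
open Literature.AlgebraicGeometry.Deligne1982 (deligne1982_cmDenseMumfordTateFamilies)
open Summit.HodgeConjecture.HodgeConjecture Summit.HodgeConjecture.HodgeConjecture.Theses
open Summit.HodgeConjecture.HodgeConjecture.Theses.RankFourFaces (CMAbelianHodge CMToAbelian RankFourWeilClasses)
open Summit.HodgeConjecture.HodgeConjecture.Theses.PadicSemiregularLift (HodgeAbelianVarieties)
open Summit.HodgeConjecture.HodgeConjecture.WeilTypeLadder (WeilClassesImaginaryQuadratic weilClassesImaginaryQuadratic_of_hodgeConjecture)
open Summit.HodgeConjecture.HodgeConjecture.Ring2.Deform (CMAnchoredPencilCMSpreading cmAnchoredPencilCMSpreading_of_cmAnchoredPencilTransport)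
open Summit.HodgeConjecture.HodgeConjecture.Ring2.ClassTargets (HCOnClass)

/-- `HC_WeilTypeDW[]` — the Hodge conjecture for every Weil-type pair `(A, φ)` (signature `(n,n)`, `K = ℚ(√-d)`) whose
Hodge classes are generated by divisors and the Weil plane (van Geemen 6.12: the general member). Local notation with the
body of typer 1's `Ring2WeilTypeHodgeRing` (verbatim). -/
local notation3 (prettyPrint := false) "HC_WeilTypeDW[]" =>
  ∀ (A : AbelianVariety ℂ) (φ : A ⟶ A) (n d : ℕ), IsWeilType A φ n d → IsDivisorWeilGenerated A φ n d →
    HodgeConjectureFor A.dim A.X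

/-! ## §B The four fact-free bottoms (census line; each a sufficient complement of `HC_CM` with NO named fact) -/

/-- **The four fact-free closing candidates of the cell** (T∃) (ab II), CPS_∃ (deform IX), U_∃ (spread IV), (β∃) (ab V): `HC_CM ∧ B ⟹
HC_AV` each, no named fact, `HC_CM` a binder. rev. 2: the (β∃) conjunct holds VACUOUSLY (hypothesis refuted, ab VIII); the instantiable
census is `closesWithCM_bottoms'`. [cite: Andre1996Motifs, §6.3 (pp. 31–33)] [cite: Abdulali1994FamiliesAV, Theorem 5.5 (p. 1130)] -/
theorem closesWithCM_bottoms :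
    ClosesWithCM CMAnchoredPencilTransport ∧ ClosesWithCM CMAnchoredPencilCMSpreading ∧
      ClosesWithCM CMDenseFamilyCMSpreading ∧ ClosesWithCM CMAnchoredPencilFibreClassLefschetz :=
  ⟨closesWithCM_cmAnchoredPencilTransport, closesWithCM_cmAnchoredPencilCMSpreading,
    closesWithCM_cmDenseFamilyCMSpreading, closesWithCM_cmAnchoredPencilFibreClassLefschetz⟩

/-- The disjunction of the four bottoms is itself ONE fact-free closing candidate. [folklore] -/
theorem closesWithCM_bottoms_or :
    ClosesWithCM (CMAnchoredPencilTransport ∨ CMAnchoredPencilCMSpreading ∨ CMDenseFamilyCMSpreading ∨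
      CMAnchoredPencilFibreClassLefschetz) :=
  fun hCM h ↦ h.elim (closesWithCM_cmAnchoredPencilTransport hCM) fun h ↦
    h.elim (closesWithCM_cmAnchoredPencilCMSpreading hCM) fun h ↦
      h.elim (closesWithCM_cmDenseFamilyCMSpreading hCM) (closesWithCM_cmAnchoredPencilFibreClassLefschetz hCM)

/-- Unfolded: `HC_CM ∧ (T∃ ∨ CPS_∃ ∨ U_∃ ∨ β∃) ⟹ HC_AV`, `HC_CM` a binder, no named fact. [cite: Andre1996Motifs, §6.3 a) (p. 33)] -/
theorem HC_AV_of_HC_CM_of_bottom (hCM : CMAbelianHodge)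
    (h : CMAnchoredPencilTransport ∨ CMAnchoredPencilCMSpreading ∨ CMDenseFamilyCMSpreading ∨
      CMAnchoredPencilFibreClassLefschetz) : HodgeAbelianVarieties :=
  closesWithCM_bottoms_or hCM h

/-- **The unconditional arrows among the bottoms**: (β∃) → (T∃) → CPS_∃ → `CMToAbelian` ← U_∃ (item 16267 stays OPEN; rev. 2: the
first arrow has a refuted antecedent — see `bottoms_edges'` for (β∃′) → (T∃);
U_∃ and the pencil bottoms are not compared in the kernel). [folklore] -/
theorem bottoms_edges :
    (CMAnchoredPencilFibreClassLefschetz → CMAnchoredPencilTransport) ∧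
      (CMAnchoredPencilTransport → CMAnchoredPencilCMSpreading) ∧ (CMAnchoredPencilCMSpreading → CMToAbelian) ∧
      (CMDenseFamilyCMSpreading → CMToAbelian) :=
  ⟨cmAnchoredPencilTransport_of_cmAnchoredPencilFibreClassLefschetz, cmAnchoredPencilCMSpreading_of_cmAnchoredPencilTransport,
    cmToAbelian_of_closesWithCM closesWithCM_cmAnchoredPencilCMSpreading, cmToAbelian_of_cmDenseFamilyCMSpreading⟩

/-! ## §E The bottoms in the `E`-rank-4 column (Frame IV rows, by name) -/

/-- **`F1 → item 16268 → (any fact-free bottom) → HC_AV`**, modulo André 1992 and Hazama 2003 — NO `HC_CM` binder: the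
`E`-rank-4 inputs stand in for it (Frame IV `HC_AV_of_closesWithCM_of_rankFour`). [cite: Hazama2003GHCCM, Thm. 8.3 (p. 655)]
[cite: CharlesSchnell2014Notes, Thm. 11.5.21 (p. 510)] -/
theorem HC_AV_of_rankFour_of_bottom (h𝔄 : Andre1992_hodgeClasses_cmAbelianVariety_mem_span_pullback_weilClasses)
    (h83 : Hazama2003_generalHodge_cmType_of_hodge_codimTwo) (hF1 : Markman2025_weilClasses_algebraic_abelianFourfold)
    (hR4 : RankFourWeilClasses)
    (h : CMAnchoredPencilTransport ∨ CMAnchoredPencilCMSpreading ∨ CMDenseFamilyCMSpreading ∨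
      CMAnchoredPencilFibreClassLefschetz) : HodgeAbelianVarieties :=
  HC_AV_of_closesWithCM_of_rankFour closesWithCM_bottoms_or h𝔄 h83 hF1 hR4 h

/-- In the grammar's words: `HC_CM` is IDLE next to `F1 ∧ item 16268 ∧ (T∃ ∨ CPS_∃ ∨ U_∃ ∨ β∃)`, mod André + Hazama.
[cite: Hazama2003GHCCM, Thm. 8.3 (p. 655)] -/
theorem cmIdle_rankFour_and_bottom (h𝔄 : Andre1992_hodgeClasses_cmAbelianVariety_mem_span_pullback_weilClasses)
    (h83 : Hazama2003_generalHodge_cmType_of_hodge_codimTwo) :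
    CMIdle (Markman2025_weilClasses_algebraic_abelianFourfold ∧ RankFourWeilClasses ∧
      (CMAnchoredPencilTransport ∨ CMAnchoredPencilCMSpreading ∨ CMDenseFamilyCMSpreading ∨
        CMAnchoredPencilFibreClassLefschetz)) :=
  cmIdle_rankFour_and_of_closesWithCM closesWithCM_bottoms_or h𝔄 h83

/-- **KIND-2 row U_∃ in the `E`-rank-4 column: `HC_AV ↔ F1 ∧ item 16268 ∧ U_∃`**, modulo André 1992, Hazama 2003 and
Deligne's family fact (spread IV `exactWithCM_cmDenseFamilyCMSpreading`, Frame IV `iff_rankFour_and_of_exactWithCM`).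
[cite: Deligne1982HodgeCycles, Prop. 6.1] [cite: CharlesSchnell2014Notes, Thm. 11.5.11] -/
theorem iff_rankFour_and_cmDenseFamilyCMSpreading (hF : deligne1982_cmDenseMumfordTateFamilies)
    (h𝔄 : Andre1992_hodgeClasses_cmAbelianVariety_mem_span_pullback_weilClasses)
    (h83 : Hazama2003_generalHodge_cmType_of_hodge_codimTwo) :
    HodgeAbelianVarieties ↔
      (Markman2025_weilClasses_algebraic_abelianFourfold ∧ RankFourWeilClasses ∧ CMDenseFamilyCMSpreading) :=
  iff_rankFour_and_of_exactWithCM (exactWithCM_cmDenseFamilyCMSpreading hF) h𝔄 h83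

/-- Row CPS_∃ in the `E`-rank-4 column: `HC_AV ↔ F1 ∧ item 16268 ∧ CPS_∃`, mod André 1992, Hazama 2003, Lemme 6.3.1.
[cite: Andre1996Motifs, Lemme 6.3.1 (p. 32)] [cite: Hazama2003GHCCM, Thm. 8.3 (p. 655)] -/
theorem iff_rankFour_and_cmAnchoredPencilCMSpreading (h₂₁ : andre1996_cmAnchoredPencil)
    (h𝔄 : Andre1992_hodgeClasses_cmAbelianVariety_mem_span_pullback_weilClasses)
    (h83 : Hazama2003_generalHodge_cmType_of_hodge_codimTwo) :
    HodgeAbelianVarieties ↔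
      (Markman2025_weilClasses_algebraic_abelianFourfold ∧ RankFourWeilClasses ∧ CMAnchoredPencilCMSpreading) :=
  iff_rankFour_and_of_exactWithCM (exactWithCM_cmSpreading_of_andre1996 h₂₁).1 h𝔄 h83

/-- Row (T∃) in the `E`-rank-4 column: `HC_AV ↔ F1 ∧ item 16268 ∧ (T∃)`, mod André 1992, Hazama 2003, Lemme 6.3.1.
[cite: Andre1996Motifs, Lemme 6.3.1 (p. 32)] [cite: Abdulali1994FamiliesAV, Theorem 5.5 (p. 1130)] -/
theorem iff_rankFour_and_cmAnchoredPencilTransport (h₂₁ : andre1996_cmAnchoredPencil)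
    (h𝔄 : Andre1992_hodgeClasses_cmAbelianVariety_mem_span_pullback_weilClasses)
    (h83 : Hazama2003_generalHodge_cmType_of_hodge_codimTwo) :
    HodgeAbelianVarieties ↔
      (Markman2025_weilClasses_algebraic_abelianFourfold ∧ RankFourWeilClasses ∧ CMAnchoredPencilTransport) :=
  iff_rankFour_and_of_exactWithCM (exactWithCM_candidates_of_andre1996 h₂₁).2.2.2.2 h𝔄 h83

/-- (rev. 2: VACUOUS — `hβ` is refuted by ab VIII `not_fibreClassLefschetzCMPointedPencils_of_pencil`; primed version
`HC_AV_of_rankFour_of_fibreClassLefschetzOnCMPointedPencils` below.) Row (β) in the `E`-rank-4 column: `F1 → item 16268 → (β) → HC_AV`,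
mod André 1992, Hazama 2003, Lemme 6.3.1 (ab V `closesWithCM_fibreClassLefschetzCMPointedPencils_of_andre1996`).
[cite: Andre1996Motifs, Remarque 2 (p. 33)] -/
theorem HC_AV_of_rankFour_of_fibreClassLefschetzCMPointedPencils (h₂₁ : andre1996_cmAnchoredPencil)
    (h𝔄 : Andre1992_hodgeClasses_cmAbelianVariety_mem_span_pullback_weilClasses)
    (h83 : Hazama2003_generalHodge_cmType_of_hodge_codimTwo) (hF1 : Markman2025_weilClasses_algebraic_abelianFourfold)
    (hR4 : RankFourWeilClasses) (hβ : FibreClassLefschetzCMPointedPencils) : HodgeAbelianVarieties :=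
  HC_AV_of_closesWithCM_of_rankFour (closesWithCM_fibreClassLefschetzCMPointedPencils_of_andre1996 h₂₁) h𝔄 h83 hF1 hR4 hβ

/-- Class axis: on ANY class `𝒞` of abelian varieties, `F1 ∧ item 16268 ∧ (any bottom) ⟹ HC on 𝒞`, mod André + Hazama.
[cite: Hazama2003GHCCM, Thm. 8.3 (p. 655)] -/
theorem hcOnClass_of_rankFour_of_bottom (h𝔄 : Andre1992_hodgeClasses_cmAbelianVariety_mem_span_pullback_weilClasses)
    (h83 : Hazama2003_generalHodge_cmType_of_hodge_codimTwo) (hF1 : Markman2025_weilClasses_algebraic_abelianFourfold)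
    (hR4 : RankFourWeilClasses)
    (h : CMAnchoredPencilTransport ∨ CMAnchoredPencilCMSpreading ∨ CMDenseFamilyCMSpreading ∨
      CMAnchoredPencilFibreClassLefschetz) (𝒞 : AbelianVariety ℂ → Prop) : HCOnClass 𝒞 :=
  hcOnClass_of_closesWithCM_of_rankFour closesWithCM_bottoms_or h𝔄 h83 hF1 hR4 h 𝒞

/-! ## §W The Weil-type junction: pencil axis (ab VII) ⟶ `HC_WeilTypeDW[]` (typer 1 `Ring2WeilTypeHodgeRing`) -/

/-- **Per-level slice.** Granted `HC_CM`, compact Weil pencils through CM points at level `n` (`(W)ₙ`) and CM-anchored transport at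
relative dimension `2n`, HC holds for every divisor–Weil-generated Weil-type `(A, φ, n, d)`: divisor part unconditionally (Lefschetz
(1,1), tree theorem), Weil part by ab VII `mem_algebraicClasses_of_HC_CM_of_weilPencilsAt_of_transport`. `HC_CM` a binder; no named
fact. [cite: vanGeemen1994HodgeAV, Thm. 6.12 (p. 232)] [cite: Abdulali1994FamiliesAV, Theorem 5.5 (p. 1130)] -/
theorem hodgeConjectureFor_of_HC_CM_of_weilPencilsAt_of_transport {n : ℕ} (hCM : CMAbelianHodge)
    (hW : CMAnchoredCompactWeilPencilsAt n) (hT : CMAnchoredTransportAtRelDim (2 * n))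
    {A : AbelianVariety ℂ} {φ : A ⟶ A} {d : ℕ} (hA : IsWeilType A φ n d) (hDW : IsDivisorWeilGenerated A φ n d) :
    HodgeConjectureFor A.dim A.X :=
  Ring2.WeilType.hodgeConjectureFor_of_isDivisorWeilGenerated_of_slice hA hDW
    fun _ _ hA' hφ' _ hc hH hcW ↦
      mem_algebraicClasses_of_HC_CM_of_weilPencilsAt_of_transport hCM hW hT hA.d_pos hA'
        (isSmoothProjective_of_dim_eq' hA') hφ' hc hH hcW

/-- (rev. 2: VACUOUS whenever a CM-pointed pencil of relative dimension `2n` exists — ab VIII; primed version below.)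
The same slice with the fibre-class Lefschetz input at relative dimension `2n` in place of transport (ab VII's graded
edge `cmAnchoredTransportAtRelDim_of_fibreClassLefschetzAtRelDim`). [cite: Andre1996Motifs, §6.3 a) (p. 33)] -/
theorem hodgeConjectureFor_of_HC_CM_of_weilPencilsAt_of_fibreClassLefschetz {n : ℕ} (hCM : CMAbelianHodge)
    (hW : CMAnchoredCompactWeilPencilsAt n) (hβ : FibreClassLefschetzAtRelDim (2 * n))
    {A : AbelianVariety ℂ} {φ : A ⟶ A} {d : ℕ} (hA : IsWeilType A φ n d) (hDW : IsDivisorWeilGenerated A φ n d) :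
    HodgeConjectureFor A.dim A.X :=
  hodgeConjectureFor_of_HC_CM_of_weilPencilsAt_of_transport hCM hW
    (cmAnchoredTransportAtRelDim_of_fibreClassLefschetzAtRelDim hβ) hA hDW

/-- **The smallest rung of the junction: `HC_CM ∧ (W)₂ ∧ T@4 ⟹ F1`** — the fourfold floor (rational `(2,2)` Weil classes
on Weil-type abelian fourfolds, every `d`; REFEREED in print only for `d ∈ {1, 3}` and split cases) from `HC_CM`, compact
Weil pencils of relative dimension 4 through CM points, and CM-anchored transport along them. `HC_CM` a binder.
[cite: Markman2025SecantWeil, Cor. 1.6.1 (UNREFEREED)] [cite: Andre1996Motifs, Lemme 6.3.1 (p. 32)] -/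
theorem markmanFourfolds_of_HC_CM_of_weilPencilsAt_two_of_transport (hCM : CMAbelianHodge)
    (hW : CMAnchoredCompactWeilPencilsAt 2) (hT : CMAnchoredTransportAtRelDim (2 * 2)) :
    Markman2025_weilClasses_algebraic_abelianFourfold :=
  fun _ hd _ _ hA hX hφ _ hc hH hcW ↦
    mem_algebraicClasses_of_HC_CM_of_weilPencilsAt_of_transport hCM hW hT hd hA hX hφ hc hH hcW

/-- **The junction, transport form: `HC_CM ∧ (∀ n ≥ 2, (W)ₙ) ∧ (∀ n ≥ 2, T@2n) ⟹ HC_WeilTypeDW[]`** — ab VII's R∞ row composed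
with typer 1's `hc_weilTypeDW_of_weilClassesImaginaryQuadratic`: HC for the GENERAL member of every Weil-type family (van Geemen 6.12),
every `K = ℚ(√-d)`, every dimension `2n`, from `HC_CM` and the pencil inputs. `HC_CM` a binder; no named fact; nothing closed.
[cite: vanGeemen1994HodgeAV, Thm. 6.12 (p. 232)] [cite: Andre1996Motifs, §6.3 (pp. 31–33)] -/
theorem hc_weilTypeDW_of_HC_CM_of_weilPencils_of_transport (hCM : CMAbelianHodge)
    (hW : ∀ n, 2 ≤ n → CMAnchoredCompactWeilPencilsAt n) (hT : ∀ n, 2 ≤ n → CMAnchoredTransportAtRelDim (2 * n)) :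
    HC_WeilTypeDW[] :=
  Ring2.WeilType.hc_weilTypeDW_of_weilClassesImaginaryQuadratic
    (HC_weilClassesImaginaryQuadratic_of_HC_CM_of_weilPencils_of_transport hCM hW hT)

/-- (rev. 2: VACUOUS — unprimed `β@2n` is refuted, ab VIII; primed version `…_of_fibreClassLefschetzOn` below.)
The junction, Lefschetz form: `HC_CM ∧ (∀ n ≥ 2, (W)ₙ) ∧ (∀ n ≥ 2, β@2n) ⟹ HC_WeilTypeDW[]`.
[cite: vanGeemen1994HodgeAV, Thm. 6.12 (p. 232)] [cite: Abdulali1994FamiliesAV, Theorem 5.5 (p. 1130)] -/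
theorem hc_weilTypeDW_of_HC_CM_of_weilPencils_of_fibreClassLefschetz (hCM : CMAbelianHodge)
    (hW : ∀ n, 2 ≤ n → CMAnchoredCompactWeilPencilsAt n) (hβ : ∀ n, 2 ≤ n → FibreClassLefschetzAtRelDim (2 * n)) :
    HC_WeilTypeDW[] :=
  Ring2.WeilType.hc_weilTypeDW_of_weilClassesImaginaryQuadratic
    (HC_weilClassesImaginaryQuadratic_of_HC_CM_of_weilPencils_of_fibreClassLefschetz hCM hW hβ)

/-- (rev. 2: VACUOUS — (β) is refuted, ab VIII; primed version below.) The junction from the GLOBAL input (β)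
`FibreClassLefschetzCMPointedPencils` (all relative dimensions at once, ab V). [cite: Andre1996Motifs, Remarque 2 (p. 33)] -/
theorem hc_weilTypeDW_of_HC_CM_of_weilPencils_of_fibreClassLefschetzCMPointedPencils (hCM : CMAbelianHodge)
    (hW : ∀ n, 2 ≤ n → CMAnchoredCompactWeilPencilsAt n) (hβ : FibreClassLefschetzCMPointedPencils) : HC_WeilTypeDW[] :=
  hc_weilTypeDW_of_HC_CM_of_weilPencils_of_fibreClassLefschetz hCM hW
    fun n _ ↦ fibreClassLefschetzCMPointedPencils_iff_forall_atRelDim.1 hβ (2 * n)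

/-- (rev. 2: VACUOUS as typed — unprimed `β@2n` is refuted, ab VIII; the CONTENTFUL statement is the primed version
`weilClassesImaginaryQuadratic_of_rankFour_of_weilPencils_of_fibreClassLefschetzOn` below, or the transport form.)
**`E`-rank-4 reading: rank FOUR Weil classes for CM fields give the Weil classes of EVERY imaginary quadratic field**,
granted the pencil inputs — `F1 ∧ item 16268 ∧ (∀ n ≥ 2, (W)ₙ) ∧ (∀ n ≥ 2, β@2n) ⟹ R∞`, modulo André 1992 and Hazama
2003 (Frame IV `HC_CM_of_andre_of_hazama_of_markmanFourfolds_of_rankFourWeilClasses`, then ab VII). NO `HC_CM` binder.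
[cite: Hazama2003GHCCM, Thm. 8.3 (p. 655)] [cite: MoonenZarhin1998WeilClasses, §1] -/
theorem weilClassesImaginaryQuadratic_of_rankFour_of_weilPencils_of_fibreClassLefschetz
    (h𝔄 : Andre1992_hodgeClasses_cmAbelianVariety_mem_span_pullback_weilClasses)
    (h83 : Hazama2003_generalHodge_cmType_of_hodge_codimTwo) (hF1 : Markman2025_weilClasses_algebraic_abelianFourfold)
    (hR4 : RankFourWeilClasses) (hW : ∀ n, 2 ≤ n → CMAnchoredCompactWeilPencilsAt n)
    (hβ : ∀ n, 2 ≤ n → FibreClassLefschetzAtRelDim (2 * n)) : WeilClassesImaginaryQuadratic :=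
  HC_weilClassesImaginaryQuadratic_of_HC_CM_of_weilPencils_of_fibreClassLefschetz
    (HC_CM_of_andre_of_hazama_of_markmanFourfolds_of_rankFourWeilClasses h𝔄 h83 hF1 hR4) hW hβ

/-- (rev. 2: VACUOUS as typed; primed version below.)
Hence `F1 ∧ item 16268 ∧ (W) ∧ β ⟹ HC_WeilTypeDW[]` (the general member of every Weil-type family), mod André + Hazama.
[cite: vanGeemen1994HodgeAV, Thm. 6.12 (p. 232)] [cite: Hazama2003GHCCM, Thm. 8.3 (p. 655)] -/
theorem hc_weilTypeDW_of_rankFour_of_weilPencils_of_fibreClassLefschetz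
    (h𝔄 : Andre1992_hodgeClasses_cmAbelianVariety_mem_span_pullback_weilClasses)
    (h83 : Hazama2003_generalHodge_cmType_of_hodge_codimTwo) (hF1 : Markman2025_weilClasses_algebraic_abelianFourfold)
    (hR4 : RankFourWeilClasses) (hW : ∀ n, 2 ≤ n → CMAnchoredCompactWeilPencilsAt n)
    (hβ : ∀ n, 2 ≤ n → FibreClassLefschetzAtRelDim (2 * n)) : HC_WeilTypeDW[] :=
  Ring2.WeilType.hc_weilTypeDW_of_weilClassesImaginaryQuadratic
    (weilClassesImaginaryQuadratic_of_rankFour_of_weilPencils_of_fibreClassLefschetz h𝔄 h83 hF1 hR4 hW hβ)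

/-! ## §A Audit: on path, inputs non-vacuous -/

/-- **Audit.** Every HC-shaped conclusion of this file is a consequence of the Hodge conjecture, and so is the
transport input at every relative dimension (ab VII): R∞, `W₆`, `∀ d, T@d`, `HC_WeilTypeDW[]` all follow from
`HodgeConjecture`. The named facts `h₂₁`, `hF`, `h𝔄`, `h83` are structure theorems, never asserted here. [cite: Deligne2000, §1] -/
theorem weilJunction_of_hodgeConjecture (h : _root_.HodgeConjecture) :
    WeilClassesImaginaryQuadratic ∧ Theses.SevenfoldWeilCensus.WeilSixfolds ∧ (∀ d, CMAnchoredTransportAtRelDim d) ∧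
      HC_WeilTypeDW[] :=
  ⟨weilClassesImaginaryQuadratic_of_hodgeConjecture h, (weilSixfolds_and_transport_of_hodgeConjecture h 0).1,
    fun d ↦ (weilSixfolds_and_transport_of_hodgeConjecture h d).2, Ring2.WeilType.hc_weilTypeDW_of_hodgeConjecture h⟩

/-! ## §B′ (rev. 2) The bottoms on ab VIII's REPAIRED fibre-class node (β∃′) — correspondences in degrees `p ≤ d` only -/

/-- **Why the unprimed (β∃) is empty**: any rational `(p,p)` class on any abelian variety refutes it (ab VIII). [folklore] -/
theorem not_bottom_beta_of_class (A : AbelianVariety ℂ) (p : ℕ) (c : complexBetti A.X (2 * p)) (hc : IsRationalClass c)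
    (hpp : IsOfHodgeType A.dim A.X (2 * p) p p c) : ¬ CMAnchoredPencilFibreClassLefschetz :=
  not_cmAnchoredPencilFibreClassLefschetz_of_class A AbelianVariety.isSmoothProjective_holds p c hc hpp

/-- **The instantiable fact-free bottoms (rev. 2)**: (T∃), CPS_∃, U_∃ and the REPAIRED (β∃′) `CMAnchoredPencilFibreClassLefschetzOn`
(ab VIII `closesWithCM_cmAnchoredPencilFibreClassLefschetzOn`) — each `HC_CM ∧ B ⟹ HC_AV`, no named fact.
[cite: Andre1996Motifs, §6.3 a) (p. 33)] [cite: Abdulali1994FamiliesAV, Theorem 5.5 (p. 1130)] -/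
theorem closesWithCM_bottoms' :
    ClosesWithCM CMAnchoredPencilTransport ∧ ClosesWithCM CMAnchoredPencilCMSpreading ∧
      ClosesWithCM CMDenseFamilyCMSpreading ∧ ClosesWithCM CMAnchoredPencilFibreClassLefschetzOn :=
  ⟨closesWithCM_cmAnchoredPencilTransport, closesWithCM_cmAnchoredPencilCMSpreading,
    closesWithCM_cmDenseFamilyCMSpreading, closesWithCM_cmAnchoredPencilFibreClassLefschetzOn⟩

/-- The disjunction of the four instantiable bottoms is ONE fact-free closing candidate (rev. 2). [folklore] -/
theorem closesWithCM_bottoms_or' :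
    ClosesWithCM (CMAnchoredPencilTransport ∨ CMAnchoredPencilCMSpreading ∨ CMDenseFamilyCMSpreading ∨
      CMAnchoredPencilFibreClassLefschetzOn) :=
  fun hCM h ↦ h.elim (closesWithCM_cmAnchoredPencilTransport hCM) fun h ↦
    h.elim (closesWithCM_cmAnchoredPencilCMSpreading hCM) fun h ↦
      h.elim (closesWithCM_cmDenseFamilyCMSpreading hCM) (closesWithCM_cmAnchoredPencilFibreClassLefschetzOn hCM)

/-- The unconditional arrows, repaired: (β∃′) → (T∃) → CPS_∃ → `CMToAbelian` ← U_∃ (ab VIII). [cite: Andre1996Motifs, §6.3 a) (p. 33)] -/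
theorem bottoms_edges' :
    (CMAnchoredPencilFibreClassLefschetzOn → CMAnchoredPencilTransport) ∧
      (CMAnchoredPencilTransport → CMAnchoredPencilCMSpreading) ∧ (CMAnchoredPencilCMSpreading → CMToAbelian) ∧
      (CMDenseFamilyCMSpreading → CMToAbelian) :=
  ⟨cmAnchoredPencilTransport_of_cmAnchoredPencilFibreClassLefschetzOn, bottoms_edges.2⟩

/-- `F1 → item 16268 → (any instantiable bottom) → HC_AV`, mod André 1992 + Hazama 2003, NO `HC_CM` binder (rev. 2).
[cite: Hazama2003GHCCM, Thm. 8.3 (p. 655)] [cite: CharlesSchnell2014Notes, Thm. 11.5.21 (p. 510)] -/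
theorem HC_AV_of_rankFour_of_bottom' (h𝔄 : Andre1992_hodgeClasses_cmAbelianVariety_mem_span_pullback_weilClasses)
    (h83 : Hazama2003_generalHodge_cmType_of_hodge_codimTwo) (hF1 : Markman2025_weilClasses_algebraic_abelianFourfold)
    (hR4 : RankFourWeilClasses)
    (h : CMAnchoredPencilTransport ∨ CMAnchoredPencilCMSpreading ∨ CMDenseFamilyCMSpreading ∨
      CMAnchoredPencilFibreClassLefschetzOn) : HodgeAbelianVarieties :=
  HC_AV_of_closesWithCM_of_rankFour closesWithCM_bottoms_or' h𝔄 h83 hF1 hR4 h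

/-- Row (β′) (REPAIRED global fibre-class Lefschetz on CM-pointed pencils, degrees `p ≤ d`) in the `E`-rank-4 column:
`F1 → item 16268 → (β′) → HC_AV`, mod André 1992, Hazama 2003, Lemme 6.3.1 (ab VIII
`closesWithCM_fibreClassLefschetzOnCMPointedPencils_of_andre1996`). [cite: Andre1996Motifs, Remarque 2 (p. 33)] -/
theorem HC_AV_of_rankFour_of_fibreClassLefschetzOnCMPointedPencils (h₂₁ : andre1996_cmAnchoredPencil)
    (h𝔄 : Andre1992_hodgeClasses_cmAbelianVariety_mem_span_pullback_weilClasses)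
    (h83 : Hazama2003_generalHodge_cmType_of_hodge_codimTwo) (hF1 : Markman2025_weilClasses_algebraic_abelianFourfold)
    (hR4 : RankFourWeilClasses) (hβ : FibreClassLefschetzOnCMPointedPencils) : HodgeAbelianVarieties :=
  HC_AV_of_closesWithCM_of_rankFour (closesWithCM_fibreClassLefschetzOnCMPointedPencils_of_andre1996 h₂₁) h𝔄 h83 hF1 hR4 hβ

/-! ## §W′ (rev. 2) The Weil-type junction on the REPAIRED graded node (β′)_d `FibreClassLefschetzOnAtRelDim d` -/

/-- Per-level slice, repaired Lefschetz form: `HC_CM ∧ (W)ₙ ∧ β′@2n ⟹ HC` for every divisor–Weil-generated Weil-type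
`(A, φ, n, d)` (ab VIII `cmAnchoredTransportAtRelDim_of_fibreClassLefschetzOnAtRelDim`). `HC_CM` a binder; no named fact.
[cite: vanGeemen1994HodgeAV, Thm. 6.12 (p. 232)] [cite: Abdulali1994FamiliesAV, Theorem 5.5 (p. 1130)] -/
theorem hodgeConjectureFor_of_HC_CM_of_weilPencilsAt_of_fibreClassLefschetzOn {n : ℕ} (hCM : CMAbelianHodge)
    (hW : CMAnchoredCompactWeilPencilsAt n) (hβ : FibreClassLefschetzOnAtRelDim (2 * n))
    {A : AbelianVariety ℂ} {φ : A ⟶ A} {d : ℕ} (hA : IsWeilType A φ n d) (hDW : IsDivisorWeilGenerated A φ n d) :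
    HodgeConjectureFor A.dim A.X :=
  hodgeConjectureFor_of_HC_CM_of_weilPencilsAt_of_transport hCM hW
    (cmAnchoredTransportAtRelDim_of_fibreClassLefschetzOnAtRelDim hβ) hA hDW

/-- **The junction, repaired Lefschetz form: `HC_CM ∧ (∀ n ≥ 2, (W)ₙ) ∧ (∀ n ≥ 2, β′@2n) ⟹ HC_WeilTypeDW[]`** (ab VIII
`HC_weilClassesImaginaryQuadratic_of_HC_CM_of_weilPencils_of_fibreClassLefschetzOn`, then typer 1's WΔ).
[cite: vanGeemen1994HodgeAV, Thm. 6.12 (p. 232)] [cite: Andre1996Motifs, Remarque 2 (p. 33)] -/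
theorem hc_weilTypeDW_of_HC_CM_of_weilPencils_of_fibreClassLefschetzOn (hCM : CMAbelianHodge)
    (hW : ∀ n, 2 ≤ n → CMAnchoredCompactWeilPencilsAt n) (hβ : ∀ n, 2 ≤ n → FibreClassLefschetzOnAtRelDim (2 * n)) :
    HC_WeilTypeDW[] :=
  Ring2.WeilType.hc_weilTypeDW_of_weilClassesImaginaryQuadratic
    (HC_weilClassesImaginaryQuadratic_of_HC_CM_of_weilPencils_of_fibreClassLefschetzOn hCM hW hβ)

/-- **`E`-rank-4 reading, repaired: `F1 ∧ item 16268 ∧ (∀ n ≥ 2, (W)ₙ) ∧ (∀ n ≥ 2, β′@2n) ⟹ R∞`**, mod André 1992 + Hazama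
2003 — rank FOUR Weil classes for CM fields plus the pencil inputs give the Weil classes of EVERY imaginary quadratic field.
NO `HC_CM` binder. [cite: Hazama2003GHCCM, Thm. 8.3 (p. 655)] [cite: MoonenZarhin1998WeilClasses, §1] -/
theorem weilClassesImaginaryQuadratic_of_rankFour_of_weilPencils_of_fibreClassLefschetzOn
    (h𝔄 : Andre1992_hodgeClasses_cmAbelianVariety_mem_span_pullback_weilClasses)
    (h83 : Hazama2003_generalHodge_cmType_of_hodge_codimTwo) (hF1 : Markman2025_weilClasses_algebraic_abelianFourfold)
    (hR4 : RankFourWeilClasses) (hW : ∀ n, 2 ≤ n → CMAnchoredCompactWeilPencilsAt n)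
    (hβ : ∀ n, 2 ≤ n → FibreClassLefschetzOnAtRelDim (2 * n)) : WeilClassesImaginaryQuadratic :=
  HC_weilClassesImaginaryQuadratic_of_HC_CM_of_weilPencils_of_fibreClassLefschetzOn
    (HC_CM_of_andre_of_hazama_of_markmanFourfolds_of_rankFourWeilClasses h𝔄 h83 hF1 hR4) hW hβ

/-- Hence, repaired: `F1 ∧ item 16268 ∧ (W) ∧ β′ ⟹ HC_WeilTypeDW[]`, mod André + Hazama. [cite: vanGeemen1994HodgeAV, Thm. 6.12 (p. 232)] -/
theorem hc_weilTypeDW_of_rankFour_of_weilPencils_of_fibreClassLefschetzOn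
    (h𝔄 : Andre1992_hodgeClasses_cmAbelianVariety_mem_span_pullback_weilClasses)
    (h83 : Hazama2003_generalHodge_cmType_of_hodge_codimTwo) (hF1 : Markman2025_weilClasses_algebraic_abelianFourfold)
    (hR4 : RankFourWeilClasses) (hW : ∀ n, 2 ≤ n → CMAnchoredCompactWeilPencilsAt n)
    (hβ : ∀ n, 2 ≤ n → FibreClassLefschetzOnAtRelDim (2 * n)) : HC_WeilTypeDW[] :=
  Ring2.WeilType.hc_weilTypeDW_of_weilClassesImaginaryQuadratic
    (weilClassesImaginaryQuadratic_of_rankFour_of_weilPencils_of_fibreClassLefschetzOn h𝔄 h83 hF1 hR4 hW hβ)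

/-! ## §W″ (rev. 3) The junction with `HC_CM` GONE — ab IX (p199083) ∘ WΔ -/

/-- **`(∀ n ≥ 2, (W_E)ₙ) ∧ (∀ n ≥ 2, T@2n) ⟹ HC_WeilTypeDW[]` — NO `HC_CM`, NO named fact, NO `E`-rank-4 input**: HC for every
determinant-`d` Weil-type abelian variety from two OPEN geometric nodes (pencils anchored at `E`-power fibres, where Tate's theorem
— a tree theorem — does `HC_CM`'s work). `HC_CM` is IDLE on the junction; nothing is closed. [cite: vanGeemen1994HodgeAV, Thm. 6.12 (p. 232)] -/
theorem hc_weilTypeDW_of_cmPowerWeilPencils_of_transport (hW : ∀ n, 2 ≤ n → CMPowerAnchoredCompactWeilPencilsAt n)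
    (hT : ∀ n, 2 ≤ n → CMAnchoredTransportAtRelDim (2 * n)) : HC_WeilTypeDW[] :=
  Ring2.WeilType.hc_weilTypeDW_of_weilClassesImaginaryQuadratic
    (weilClassesImaginaryQuadratic_of_cmPowerWeilPencils_of_transport hW hT)

/-- Same with the repaired β-Lefschetz `β′@2n` for transport — NO `HC_CM`. [cite: Abdulali1994FamiliesAV, Conjecture 5.3 (p. 1130)] -/
theorem hc_weilTypeDW_of_cmPowerWeilPencils_of_fibreClassLefschetzOn (hW : ∀ n, 2 ≤ n → CMPowerAnchoredCompactWeilPencilsAt n)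
    (hβ : ∀ n, 2 ≤ n → FibreClassLefschetzOnAtRelDim (2 * n)) : HC_WeilTypeDW[] :=
  Ring2.WeilType.hc_weilTypeDW_of_weilClassesImaginaryQuadratic
    (weilClassesImaginaryQuadratic_of_cmPowerWeilPencils_of_fibreClassLefschetzOn hW hβ)

end Summit.HodgeConjecture.HodgeConjecture.Ring2.AbelianAll

end
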